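import Summits.PneNP.PneNP.Theorems.EquivariantThetaLiftEquivariantStructureSq
import Summits.PneNP.PneNP.Theorems.EquivariantThetaLiftInvariantSubspaceLowDegree
import Summits.PneNP.PneNP.Theorems.EquivariantThetaLiftMatchingEffectiveDerivationV
import Summits.PneNP.PneNP.Theorems.EquivariantThetaLiftGrigorievMod2
import HarnessLib

/-!
# Route `EquivariantThetaLift`: the `Target` (rung leaf R2) and the `Assembly`

With all four items of the route proved in the tree (`EquivariantStructureSq_proof`,
`InvariantSubspaceLowDegree_proof`, `MatchingEffectiveDerivationV_proof`, `GrigorievMod2_proof`), the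
planner's deciding theorem `Summit.PneNP.PneNP.Theses.EquivariantThetaLift.closes` yields the route's
`Target` — token-for-token the rung leaf `Summit.PneNP.MatchingPsdRank.MatchingEquivariantPsdBound`:
there are `α > 0` and `n₀` such that for every even `n ≥ n₀` every `S_n`-equivariant psd factorization
of the odd-cut slack matrix of `P_PM(K_n)` has size `d ≥ 2^{αn}` (Braun–Brown-Cohen–Huq–Pokutta–
Raghavendra–Roy–Weitz–Zink 2017, Thm. 4.10 at `ε = 0`, psd-lift form). The same statement is also
proved directly in `Literature/Combinatorics/Optimization/MatchingEquivariantPsdLowerBound.lean`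
(`matchingEquivariantPsdBound`).
-/

set_option linter.dupNamespace false -- `Summit.PneNP.PneNP.…`: summit = sub-problem (D-0017)

namespace Summit.PneNP.PneNP.Theorems

open Summit.PneNP.PneNP.Theses.EquivariantThetaLift

/-- **The `Assembly` item of route `EquivariantThetaLift`** (the planner's glue, restated as an item).
[cite: BraunEtAl2016, Thm. 4.10] -/
theorem Assembly_proof : Summit.PneNP.PneNP.Theses.EquivariantThetaLift.Assembly :=
  fun hS hD hDer hG => closes hS hD hDer hG

/-- **The `Target` of route `EquivariantThetaLift` = rung leaf R2 (`MatchingEquivariantPsdBound`)**: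
exponential lower bound for `S_n`-equivariant psd lifts of the perfect matching polytope.
[cite: BraunEtAl2016, Thm. 4.10] -/
theorem Target_proof : Summit.PneNP.PneNP.Theses.EquivariantThetaLift.Target :=
  closes EquivariantStructureSq_proof InvariantSubspaceLowDegree_proof MatchingEffectiveDerivationV_proof
    GrigorievMod2_proof

end Summit.PneNP.PneNP.Theorems
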